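import Mathlib.Analysis.Calculus.ContDiff.Basic
import Mathlib.Analysis.Calculus.ContDiff.FTaylorSeries
import Mathlib.MeasureTheory.Integral.IntegralEqImproper
import Mathlib.MeasureTheory.Constructions.Pi
import Mathlib.MeasureTheory.Integral.Prod
import Mathlib.Analysis.Calculus.FDeriv.Pi
import HarnessLib

/-!
# The sup of a compactly supported function is bounded by the `L¹` norm of its full mixed partial derivative

Topic `Literature/Analysis/Calculus`. Theorems only.

For `g ∈ C^n_c(ℝⁿ)` (here `ℝⁿ = Fin n → ℝ` with the product Lebesgue measure) and every point `a`,

  `|g(a)| ≤ ∫_{ℝⁿ} |∂₁ ∂₂ ⋯ ∂ₙ g(x)| dx`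

(`abs_le_integral_abs_mixedPartial`), the `n`-fold iterate of the one-variable fact `g(b) = ∫_{−∞}^b g′`
(Mathlib `HasCompactSupport.integral_Iic_deriv_eq`) — the elementary endpoint Sobolev inequality behind
`W^{n,1}(ℝⁿ) ⊂ C⁰`. The mixed partial is rendered as the iterated Fréchet derivative evaluated on the coordinate vectors,
`iteratedFDeriv ℝ n g x (k ↦ e_{n−1−k})` (the innermost differentiation is in `e₀`); the induction peels off the coordinate
`0` (`Fin.cons`, `MeasurableEquiv.piFinSuccAbove _ 0`, `iteratedFDeriv_succ_apply_right`).

Written for the "diagonal restriction" estimate used to bound singular integral operators with smoothly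
parameter-dependent kernels (`Literature/Analysis/SingularIntegrals/`).

## References

* [folklore]; e.g. E. M. Stein, *Singular Integrals and Differentiability Properties of Functions* (1970), Ch. V §2.3
  (the `W^{n,1} ⊂ L^∞` endpoint via the fundamental theorem of calculus).
-/

noncomputable section

open MeasureTheory Set Filter Function
open scoped Topology

namespace Literature.Analysis.Calculus

/-- The linear map `y ↦ Fin.cons 0 y : ℝⁿ → ℝⁿ⁺¹`. [folklore] -/
theorem exists_clm_cons_zero (n : ℕ) :
    ∃ L : (Fin n → ℝ) →L[ℝ] (Fin (n + 1) → ℝ), ∀ y, L y = Fin.cons 0 y := by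
  refine ⟨ContinuousLinearMap.pi (Fin.cons (0 : (Fin n → ℝ) →L[ℝ] ℝ) fun k ↦ ContinuousLinearMap.proj k), fun y ↦ ?_⟩
  funext j
  refine Fin.cases ?_ (fun k ↦ ?_) j
  · simp
  · simp

/-- `Fin.cons t y = t • e₀ + Fin.cons 0 y`. [folklore] -/
theorem cons_eq_smul_add (n : ℕ) (t : ℝ) (y : Fin n → ℝ) :
    (Fin.cons t y : Fin (n + 1) → ℝ) = t • (Pi.single 0 1 : Fin (n + 1) → ℝ) + Fin.cons 0 y := by
  funext j
  refine Fin.cases ?_ (fun k ↦ ?_) j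
  · simp
  · simp [Fin.succ_ne_zero]

/-- Continuity of the line `t ↦ Fin.cons t y`. [folklore] -/
theorem continuous_cons_left (n : ℕ) (y : Fin n → ℝ) : Continuous fun t : ℝ ↦ (Fin.cons t y : Fin (n + 1) → ℝ) := by
  refine continuous_pi fun j ↦ Fin.cases ?_ (fun k ↦ ?_) j
  · simp only [Fin.cons_zero]; exact continuous_id'
  · simp only [Fin.cons_succ]; exact continuous_const

/-- `init` of the reversed coordinate basis of `ℝⁿ⁺¹` is `Fin.cons 0` of the reversed basis of `ℝⁿ`. [folklore] -/
theorem init_rev_basis (n : ℕ) (k : Fin n) :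
    Fin.init (fun k : Fin (n + 1) ↦ (Pi.single (Fin.rev k) (1 : ℝ) : Fin (n + 1) → ℝ)) k =
      Fin.cons 0 (Pi.single (Fin.rev k) (1 : ℝ) : Fin n → ℝ) := by
  simp only [Fin.init, Fin.rev_castSucc]
  funext j
  refine Fin.cases ?_ (fun l ↦ ?_) j
  · simp [Fin.succ_ne_zero]
  · simp [Pi.single_apply, Fin.succ_inj]

/-- **Slicing identity for the mixed partial**: for `g ∈ C^{n+1}`,
`∂₁⋯∂ₙ₊₁ g (t, y) = ∂₁⋯∂ₙ [y ↦ ∂₀ g(t, y)] (y)` in the `iteratedFDeriv` rendering. [folklore] -/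
theorem iteratedFDeriv_succ_cons_eq {n : ℕ} {g : (Fin (n + 1) → ℝ) → ℝ} (hg : ContDiff ℝ (n + 1) g) (t : ℝ)
    (y : Fin n → ℝ) :
    iteratedFDeriv ℝ (n + 1) g (Fin.cons t y) (fun k ↦ Pi.single (Fin.rev k) 1) =
      iteratedFDeriv ℝ n (fun y' : Fin n → ℝ ↦ fderiv ℝ g (Fin.cons t y') (Pi.single 0 1)) y
        (fun k ↦ Pi.single (Fin.rev k) 1) := by
  rw [iteratedFDeriv_succ_apply_right]
  have hlast : (Pi.single (Fin.last n).rev (1 : ℝ) : Fin (n + 1) → ℝ) = Pi.single 0 1 := by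
    rw [Fin.rev_last]
  rw [hlast]
  -- evaluation at `e₀` commutes with `iteratedFDeriv`
  have hfg : ContDiff ℝ n (fun x ↦ fderiv ℝ g x) := hg.fderiv_right (m := n) (by norm_cast)
  have heval : (fun x ↦ fderiv ℝ g x (Pi.single 0 1)) =
      (ContinuousLinearMap.apply ℝ ℝ (Pi.single 0 1 : Fin (n + 1) → ℝ)) ∘ fun x ↦ fderiv ℝ g x := by
    funext x; rfl
  have h1 : ∀ (x : Fin (n + 1) → ℝ) (m : Fin n → (Fin (n + 1) → ℝ)),
      iteratedFDeriv ℝ n (fun x ↦ fderiv ℝ g x) x m (Pi.single 0 1) =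
        iteratedFDeriv ℝ n (fun x ↦ fderiv ℝ g x (Pi.single 0 1)) x m := by
    intro x m
    rw [heval, ContinuousLinearMap.iteratedFDeriv_comp_left _ hfg.contDiffAt le_rfl]
    rfl
  rw [h1]
  -- compose with the affine slice map `y' ↦ Fin.cons t y' = L y' + c`
  obtain ⟨L, hL⟩ := exists_clm_cons_zero n
  have hFn : ContDiff ℝ n (fun x : Fin (n + 1) → ℝ ↦ fderiv ℝ g x (Pi.single 0 1)) :=
    (ContinuousLinearMap.apply ℝ ℝ (Pi.single 0 1 : Fin (n + 1) → ℝ)).contDiff.comp hfg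
  have hLc : ∀ y' : Fin n → ℝ, L y' + Fin.cons t 0 = Fin.cons t y' := by
    intro y'
    rw [hL]
    funext j
    refine Fin.cases ?_ (fun k ↦ ?_) j <;> simp
  have hslice : (fun y' : Fin n → ℝ ↦ fderiv ℝ g (Fin.cons t y') (Pi.single 0 1)) =
      (fun z ↦ fderiv ℝ g (z + Fin.cons t 0) (Pi.single 0 1)) ∘ L := by
    funext y'
    simp only [comp_apply, hLc y']
  have hFc : ContDiff ℝ n (fun z : Fin (n + 1) → ℝ ↦ fderiv ℝ g (z + Fin.cons t 0) (Pi.single 0 1)) :=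
    hFn.comp (contDiff_id.add contDiff_const)
  rw [hslice, ContinuousLinearMap.iteratedFDeriv_comp_right L hFc y le_rfl,
    ContinuousMultilinearMap.compContinuousLinearMap_apply,
    iteratedFDeriv_comp_add_right (f := fun x ↦ fderiv ℝ g x (Pi.single 0 1)), hLc y]
  congr 1
  funext k
  rw [hL, init_rev_basis]

/-- Compact support of a slice `t ↦ g (Fin.cons t y)`. [folklore] -/
theorem hasCompactSupport_cons_left {n : ℕ} {g : (Fin (n + 1) → ℝ) → ℝ} (hg : HasCompactSupport g)
    (y : Fin n → ℝ) : HasCompactSupport fun t : ℝ ↦ g (Fin.cons t y) := by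
  refine HasCompactSupport.intro (K := (fun x : Fin (n + 1) → ℝ ↦ x 0) '' tsupport g)
    (hg.image (continuous_apply 0)) fun t ht ↦ ?_
  apply image_eq_zero_of_notMem_tsupport
  intro hmem
  exact ht ⟨_, hmem, by simp⟩

/-- Compact support of a slice `y ↦ g (Fin.cons t y)`. [folklore] -/
theorem hasCompactSupport_cons_right {n : ℕ} {g : (Fin (n + 1) → ℝ) → ℝ} (hg : HasCompactSupport g)
    (t : ℝ) : HasCompactSupport fun y : Fin n → ℝ ↦ g (Fin.cons t y) := by
  refine HasCompactSupport.intro (K := (fun x : Fin (n + 1) → ℝ ↦ Fin.tail x) '' tsupport g)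
    (hg.image (continuous_pi fun j ↦ continuous_apply _)) fun y hy ↦ ?_
  apply image_eq_zero_of_notMem_tsupport
  intro hmem
  exact hy ⟨_, hmem, by simp⟩

/-- The mixed-partial integrand `x ↦ |∂₁⋯∂ₙ g(x)|` of a `C^n_c` function is continuous with compact support, hence
integrable. [folklore] -/
theorem integrable_abs_mixedPartial {n : ℕ} {g : (Fin n → ℝ) → ℝ} (hg : ContDiff ℝ n g) (hgc : HasCompactSupport g) :
    Continuous (fun x ↦ |iteratedFDeriv ℝ n g x (fun k ↦ Pi.single (Fin.rev k) 1)|) ∧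
      Integrable (fun x ↦ |iteratedFDeriv ℝ n g x (fun k ↦ Pi.single (Fin.rev k) 1)|) volume := by
  have hc : Continuous fun x ↦ |iteratedFDeriv ℝ n g x (fun k ↦ Pi.single (Fin.rev k) 1)| :=
    continuous_abs.comp ((ContinuousMultilinearMap.apply ℝ (fun _ : Fin n ↦ Fin n → ℝ) ℝ
      (fun k ↦ Pi.single (Fin.rev k) 1)).continuous.comp (hg.continuous_iteratedFDeriv le_rfl))
  have hs : HasCompactSupport fun x ↦ |iteratedFDeriv ℝ n g x (fun k ↦ Pi.single (Fin.rev k) 1)| := by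
    refine HasCompactSupport.intro (hgc.iteratedFDeriv (𝕜 := ℝ) n).isCompact fun x hx ↦ ?_
    have h0 : iteratedFDeriv ℝ n g x = 0 := image_eq_zero_of_notMem_tsupport hx
    simp [h0]
  exact ⟨hc, hc.integrable_of_hasCompactSupport hs⟩

/-- **`|g(a)| ≤ ∫ |∂₁⋯∂ₙ g|` for `g ∈ C^n_c(ℝⁿ)`** (iterated fundamental theorem of calculus). [folklore] -/
theorem abs_le_integral_abs_mixedPartial : ∀ (n : ℕ) (g : (Fin n → ℝ) → ℝ), ContDiff ℝ n g →
    HasCompactSupport g → ∀ a : Fin n → ℝ,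
      |g a| ≤ ∫ x : Fin n → ℝ, |iteratedFDeriv ℝ n g x (fun k ↦ Pi.single (Fin.rev k) 1)| := by
  intro n
  induction n with
  | zero =>
    intro g _ _ a
    simp only [iteratedFDeriv_zero_apply]
    rw [MeasureTheory.volume_pi, Measure.pi_of_empty (x := a), integral_dirac]
  | succ n ih =>
    intro g hg hgc a
    set t₀ : ℝ := a 0
    set y₀ : Fin n → ℝ := Fin.tail a
    have ha : a = Fin.cons t₀ y₀ := (Fin.cons_self_tail a).symm
    -- the first partial `F = ∂₀ g` and its slices `h t = F (t, ·)`
    set F : (Fin (n + 1) → ℝ) → ℝ := fun x ↦ fderiv ℝ g x (Pi.single 0 1) with hF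
    have hFn : ContDiff ℝ n F :=
      (ContinuousLinearMap.apply ℝ ℝ (Pi.single 0 1 : Fin (n + 1) → ℝ)).contDiff.comp
        (hg.fderiv_right (m := n) (by norm_cast))
    have hFc : HasCompactSupport F := hgc.fderiv_apply (𝕜 := ℝ) (Pi.single 0 1 : Fin (n + 1) → ℝ)
    obtain ⟨L, hL⟩ := exists_clm_cons_zero n
    have hcons_smooth : ∀ t, ContDiff ℝ n (fun y : Fin n → ℝ ↦ (Fin.cons t y : Fin (n + 1) → ℝ)) := by
      intro t
      have : (fun y : Fin n → ℝ ↦ (Fin.cons t y : Fin (n + 1) → ℝ)) =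
          fun y ↦ t • (Pi.single 0 1 : Fin (n + 1) → ℝ) + L y := by
        funext y; rw [cons_eq_smul_add n t y, hL y]
      rw [this]
      exact contDiff_const.add L.contDiff
    have hhn : ∀ t, ContDiff ℝ n (fun y : Fin n → ℝ ↦ F (Fin.cons t y)) := fun t ↦ hFn.comp (hcons_smooth t)
    have hhc : ∀ t, HasCompactSupport (fun y : Fin n → ℝ ↦ F (Fin.cons t y)) := fun t ↦
      hasCompactSupport_cons_right hFc t
    -- Step 1: one-variable FTC in the coordinate `0`
    set G : ℝ → ℝ := fun t ↦ g (Fin.cons t y₀) with hG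
    have hline : ∀ t, HasDerivAt (fun t : ℝ ↦ (Fin.cons t y₀ : Fin (n + 1) → ℝ)) (Pi.single 0 1) t := by
      intro t
      have h := ((hasDerivAt_id t).smul_const (Pi.single 0 1 : Fin (n + 1) → ℝ)).add_const (Fin.cons 0 y₀)
      simp only [one_smul, id] at h
      exact h.congr_of_eventuallyEq (Eventually.of_forall fun s ↦ cons_eq_smul_add n s y₀)
    have hGd : ∀ t, HasDerivAt G (F (Fin.cons t y₀)) t := fun t ↦
      ((hg.differentiable (by simp)) _).hasFDerivAt.comp_hasDerivAt t (hline t)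
    have hline_smooth : ContDiff ℝ 1 (fun t : ℝ ↦ (Fin.cons t y₀ : Fin (n + 1) → ℝ)) := by
      have : (fun t : ℝ ↦ (Fin.cons t y₀ : Fin (n + 1) → ℝ)) =
          fun t ↦ t • (Pi.single 0 1 : Fin (n + 1) → ℝ) + Fin.cons 0 y₀ := by
        funext t; exact cons_eq_smul_add n t y₀
      rw [this]
      exact (contDiff_id.smul contDiff_const).add contDiff_const
    have hG1 : ContDiff ℝ 1 G := (hg.of_le (by exact_mod_cast Nat.le_add_left 1 n)).comp hline_smooth
    have hGc : HasCompactSupport G := hasCompactSupport_cons_left hgc y₀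
    have hderiv : deriv G = fun t ↦ F (Fin.cons t y₀) := funext fun t ↦ (hGd t).deriv
    have hdGi : Integrable (fun t ↦ |F (Fin.cons t y₀)|) volume :=
      ((hFn.continuous.comp (continuous_cons_left n y₀)).abs).integrable_of_hasCompactSupport
        (hasCompactSupport_cons_left hFc y₀).abs
    -- Step 2: the integrand of the conclusion and Fubini over `ℝ × ℝⁿ`
    set Φ : (Fin (n + 1) → ℝ) → ℝ := fun x ↦ |iteratedFDeriv ℝ (n + 1) g x (fun k ↦ Pi.single (Fin.rev k) 1)|
      with hΦ
    obtain ⟨hΦc, hΦi⟩ := integrable_abs_mixedPartial hg hgc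
    set e := MeasurableEquiv.piFinSuccAbove (fun _ : Fin (n + 1) ↦ ℝ) 0 with he
    have hemp : MeasurePreserving e (volume : Measure (Fin (n + 1) → ℝ)) (volume : Measure (ℝ × (Fin n → ℝ))) :=
      volume_preserving_piFinSuccAbove (fun _ : Fin (n + 1) ↦ ℝ) 0
    have hesymm : ∀ p : ℝ × (Fin n → ℝ), e.symm p = Fin.cons p.1 p.2 := fun p ↦ Fin.insertNth_zero' p.1 p.2
    have hΦi' : Integrable (fun p : ℝ × (Fin n → ℝ) ↦ Φ (Fin.cons p.1 p.2)) (volume.prod volume) := by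
      have h1 : Integrable (Φ ∘ e.symm) (volume : Measure (ℝ × (Fin n → ℝ))) :=
        ((hemp.symm e).integrable_comp_emb e.symm.measurableEmbedding).2 hΦi
      exact h1.congr (ae_of_all _ fun p ↦ by simp only [comp_apply, hesymm p])
    have hFub : ∫ x, Φ x = ∫ t : ℝ, ∫ y : Fin n → ℝ, Φ (Fin.cons t y) := by
      have h1 : ∫ x, Φ x = ∫ p, Φ (e.symm p) ∂(volume : Measure (ℝ × (Fin n → ℝ))) :=
        ((hemp.symm e).integral_comp' (f := e.symm) Φ).symm
      rw [h1]
      simp only [hesymm]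
      exact integral_prod _ hΦi'
    -- Step 3: chain the two one-step bounds
    calc |g a| = |G t₀| := by rw [ha]
      _ = |∫ t in Iic t₀, deriv G t| := by rw [hGc.integral_Iic_deriv_eq hG1 t₀]
      _ ≤ ∫ t in Iic t₀, |deriv G t| := abs_integral_le_integral_abs
      _ ≤ ∫ t, |deriv G t| := by
          rw [hderiv]
          exact setIntegral_le_integral hdGi (ae_of_all _ fun t ↦ abs_nonneg _)
      _ ≤ ∫ t, ∫ y, Φ (Fin.cons t y) := by
          rw [hderiv]
          refine integral_mono hdGi hΦi'.integral_prod_left fun t ↦ ?_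
          calc |F (Fin.cons t y₀)|
              ≤ ∫ y, |iteratedFDeriv ℝ n (fun y : Fin n → ℝ ↦ F (Fin.cons t y)) y (fun k ↦ Pi.single (Fin.rev k) 1)| :=
                ih _ (hhn t) (hhc t) y₀
            _ = ∫ y, Φ (Fin.cons t y) := by
                congr 1; funext y
                simp only [hΦ, hF]
                rw [iteratedFDeriv_succ_cons_eq hg t y]
      _ = ∫ x, Φ x := hFub.symm

end Literature.Analysis.Calculus

end
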